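import Mathlib
import HarnessLib
import Summits.HubbardSuperconductivity.HubbardSuperconductivity.Theorems.KLProgrammeThermalGreenHubbardTorusExact

/-!
# Schwinger–Dyson for the Hubbard torus with the HALF-SHIFTED dressed mode `T′ = T − ½c`: the re-amputation by the
# Hartree-shifted free propagator `1/(−ik₀ + ξ + U/2)` is EXACTLY `U·⟨{T′,c†}⟩ − U²·∫₀^β e^{ik₀τ}⟨T′(τ)T′†⟩dτ`
# (seat hubbard-kl-k3c5-p1 g5, technique «stub_asm_matsubara suppliers»; VL child `KLRegimeVolumeLimitV14`, stmt-HubbardSuperconductivity-19921)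

`…ThermalGreenHubbardTorusExact` (k3c5-p2) proved, for `H′ = hubbardTorusWith 2 L 1 U μ`, `ξ = ε_L(k) − μ`, `c = c_{k↑}`, the dressed mode
`T = (Σ_z L⁻¹χ_k(z) n_{z↓} c†_{z↑})ᴴ` (`[H′, c] = −ξc − UT`) and the BARE propagator `D = −ik₀ + ξ`, the exact relation
`(1/D − 𝒢)·D² = U⟨{T,c†}⟩ − U²𝒵`; its frame version (`…Frame`) re-amputates by `D_κ = D + κ` at the price of the factors `D_κ/D`.
The VL carrier of the tree is re-amputated by the HARTREE-SHIFTED propagator: the Grassmann side works at chemical potential `μ₀` with the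
interaction `U(n↑−½)(n↓−½)`, i.e. the Hamiltonian `hubbardTorusWith 2 L 1 U (μ₀ + U/2)` against `D = −ik₀ + ε − μ₀` (`klSelfEnergyInf_zero_eq_reamputated`,
`norm_reamputatedProxy_le`).  For THIS shift (`κ = U/2`) the factors `D_κ/D` disappear if the dressed mode is shifted too: with

  `T′ := T − ½c`,  `[H′, c] = −(ξ + U/2)·c − U·T′`  (`hubbardTorusWith_commutator_momentumAnnihilation_shifted`),

the two Schwinger–Dyson relations hold VERBATIM with `(ξ, T)` replaced by `(ξ + U/2, T′)` (`matsubara_dyson_shifted`: one fermionic Matsubara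
integration by parts each, KMS boundary terms, the derivative-moving identity — k3c5-p2's `fermionic_matsubara_ibp` /
`gibbsState_imagTimeEvolve_comm_mul`), hence, with `D′ = −ik₀ + ξ + U/2`, `𝒢 = ∫₀^β e^{ik₀τ}⟨c(τ)c†⟩`, `𝒵′ = ∫₀^β e^{ik₀τ}⟨T′(τ)T′†⟩`:

  **`(1/D′ − 𝒢)·D′² = U·⟨T′c† + c†T′⟩ − U²·𝒵′`**   (`reamputated_matsubaraGreen_shifted_eq`), EXACTLY, for every real `U, μ, β`, `L ≥ 3`,
  every torus momentum and every fermionic `k₀`;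

and since `‖T′‖ ≤ 3/2` (`norm_shiftedDressed_le`): `‖𝒵′‖ ≤ (9/4)β` (`norm_shiftedDressedMatsubara_le`) and
`‖(1/D′ − 𝒢)·D′²‖ ≤ 3|U| + (9/4)β U²` (`norm_reamputated_matsubaraGreen_shifted_le`) — no `D_κ/D` factors, no `1/|k₀|`.
Use (next file of this seat): `U·occ∞ + U²·Six∞_L(n,p) = U⟨{T′,c†}⟩ − U²𝒵′(n)` label by label ⇒ (Riemann–Lebesgue in `n`) `occ∞ = ⟨{T′,c†}⟩` and
**`Six∞_L(n,p) = −𝒵′(n)`**: the six-point scalar of the VL child IS minus the two-time Matsubara transform of the shifted dressed mode, whence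
the `U`-UNIFORM bound `‖Six∞‖ ≤ (9/4)β`.  Everything is proved; no definition.
-/

noncomputable section

namespace Summit.HubbardSuperconductivity.HubbardSuperconductivity.Theorems.ThermalGreen

set_option linter.dupNamespace false -- summit = problem name (single-conjunct summit), D-0017

open scoped Matrix.Norms.L2Operator ComplexConjugate ComplexOrder
open Matrix Complex MeasureTheory intervalIntegral Literature.MathematicalPhysics.QuantumLattice Literature.Probability.LatticeModels
open HubbardWave0

variable {L : ℕ} [NeZero L]

/-! ## §1 The commutators with the half-shifted dressed mode -/

/-- **`[H − μN, c_{k↑}] = −(ε_L(k) − μ + U/2)·c_{k↑} − U·(T_k − ½c_{k↑})`** (`L ≥ 3`): the Hartree-shifted splitting of the commutator. -/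
theorem hubbardTorusWith_commutator_momentumAnnihilation_shifted (hL : 3 ≤ L) (U μ : ℝ) (k : TorusSite 2 L) :
    hubbardTorusWith 2 L 1 U μ * momentumAnnihilation k 0 - momentumAnnihilation k 0 * hubbardTorusWith 2 L 1 U μ =
      (-((torusBand L k - μ + U / 2 : ℝ) : ℂ)) • momentumAnnihilation k 0 + (-(U : ℂ)) • ((∑ z : FermionTorus 2 L, (torusFourierWeight 2 L * torusChar k z.toTorusSite) • (numberOp z 1 * creation (orb z 0)))ᴴ - (1 / 2 : ℂ) • momentumAnnihilation k 0) := by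
  rw [hubbardTorusWith_commutator_momentumAnnihilation hL U μ k]
  push_cast
  module

/-- **`[H − μN, c†_{k↑}] = (ε_L(k) − μ + U/2)·c†_{k↑} + U·(T_k − ½c_{k↑})ᴴ`** (`L ≥ 3`; adjoint form). -/
theorem hubbardTorusWith_commutator_momentumCreation_shifted (hL : 3 ≤ L) (U μ : ℝ) (k : TorusSite 2 L) :
    hubbardTorusWith 2 L 1 U μ * momentumCreation k 0 - momentumCreation k 0 * hubbardTorusWith 2 L 1 U μ =
      ((torusBand L k - μ + U / 2 : ℝ) : ℂ) • momentumCreation k 0 + (U : ℂ) • ((∑ z : FermionTorus 2 L, (torusFourierWeight 2 L * torusChar k z.toTorusSite) • (numberOp z 1 * creation (orb z 0)))ᴴ - (1 / 2 : ℂ) • momentumAnnihilation k 0)ᴴ := by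
  have hct : ((∑ z : FermionTorus 2 L, (torusFourierWeight 2 L * torusChar k z.toTorusSite) • (numberOp z 1 * creation (orb z 0)))ᴴ - (1 / 2 : ℂ) • momentumAnnihilation k 0)ᴴ = (∑ z : FermionTorus 2 L, (torusFourierWeight 2 L * torusChar k z.toTorusSite) • (numberOp z 1 * creation (orb z 0))) - (1 / 2 : ℂ) • momentumCreation k 0 := by
    rw [conjTranspose_sub, conjTranspose_smul, conjTranspose_conjTranspose, momentumAnnihilation_conjTranspose]
    congr 2
    simp
  rw [hct, hubbardTorusWith_commutator_momentumCreation hL U μ k]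
  push_cast
  module

/-- `‖T_k − ½c_{k↑}‖ ≤ 3/2`, uniformly in the volume. -/
theorem norm_shiftedDressed_le (k : TorusSite 2 L) : ‖((∑ z : FermionTorus 2 L, (torusFourierWeight 2 L * torusChar k z.toTorusSite) • (numberOp z 1 * creation (orb z 0)))ᴴ - (1 / 2 : ℂ) • momentumAnnihilation k 0)‖ ≤ 3 / 2 := by
  refine (norm_sub_le _ _).trans ?_
  have h1 := norm_dressed_conjTranspose_le_one k
  have h2 : ‖(1 / 2 : ℂ) • (momentumAnnihilation k 0 : Matrix (Finset (Orb (FermionTorus 2 L))) _ ℂ)‖ ≤ 1 / 2 := by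
    rw [norm_smul]
    have : ‖(1 / 2 : ℂ)‖ = 1 / 2 := by simp
    rw [this]
    exact mul_le_of_le_one_right (by norm_num) (norm_momentumAnnihilation_le_one k 0)
  linarith

/-- `‖(T_k − ½c_{k↑})ᴴ‖ ≤ 3/2`. -/
theorem norm_shiftedDressed_conjTranspose_le (k : TorusSite 2 L) : ‖((∑ z : FermionTorus 2 L, (torusFourierWeight 2 L * torusChar k z.toTorusSite) • (numberOp z 1 * creation (orb z 0)))ᴴ - (1 / 2 : ℂ) • momentumAnnihilation k 0)ᴴ‖ ≤ 3 / 2 := by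
  rw [Matrix.l2_opNorm_conjTranspose]
  exact norm_shiftedDressed_le k

/-! ## §2 The two Schwinger–Dyson relations with the half-shifted mode -/

/-- **The two Schwinger–Dyson relations, Hartree-shifted form.**  With `H′ = H − μN`, `c = c_{k↑}`, `T′ = T_k − ½c`, `ξ′ = ε_L(k) − μ + U/2` and a
fermionic `k₀`: (1) `𝒢·(−ik₀ + ξ′) = 1 − U·𝒴′` and (2) `𝒴′·(−ik₀ + ξ′) = ⟨T′c† + c†T′⟩ − U·𝒵′`
(`𝒴′ = ∫₀^β e^{ik₀τ}⟨T′(τ)c†⟩`, `𝒵′ = ∫₀^β e^{ik₀τ}⟨T′(τ)T′†⟩`). -/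
theorem matsubara_dyson_shifted (hL : 3 ≤ L) (U μ β : ℝ) (k : TorusSite 2 L) {k₀ : ℝ} (hk : cexp (I * k₀ * β) = -1) :
    (∫ τ in (0 : ℝ)..β, cexp (I * k₀ * τ) * gibbsState β (hubbardTorusWith 2 L 1 U μ) (imagTimeEvolve (hubbardTorusWith 2 L 1 U μ) (τ : ℂ) (momentumAnnihilation k 0) * momentumCreation k 0)) *
        (-I * k₀ + ((torusBand L k - μ + U / 2 : ℝ) : ℂ)) =
      1 - (U : ℂ) * ∫ τ in (0 : ℝ)..β, cexp (I * k₀ * τ) * gibbsState β (hubbardTorusWith 2 L 1 U μ) (imagTimeEvolve (hubbardTorusWith 2 L 1 U μ) (τ : ℂ) ((∑ z : FermionTorus 2 L, (torusFourierWeight 2 L * torusChar k z.toTorusSite) • (numberOp z 1 * creation (orb z 0)))ᴴ - (1 / 2 : ℂ) • momentumAnnihilation k 0) * momentumCreation k 0) ∧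
    (∫ τ in (0 : ℝ)..β, cexp (I * k₀ * τ) * gibbsState β (hubbardTorusWith 2 L 1 U μ) (imagTimeEvolve (hubbardTorusWith 2 L 1 U μ) (τ : ℂ) ((∑ z : FermionTorus 2 L, (torusFourierWeight 2 L * torusChar k z.toTorusSite) • (numberOp z 1 * creation (orb z 0)))ᴴ - (1 / 2 : ℂ) • momentumAnnihilation k 0) * momentumCreation k 0)) *
        (-I * k₀ + ((torusBand L k - μ + U / 2 : ℝ) : ℂ)) =
      gibbsState β (hubbardTorusWith 2 L 1 U μ) (((∑ z : FermionTorus 2 L, (torusFourierWeight 2 L * torusChar k z.toTorusSite) • (numberOp z 1 * creation (orb z 0)))ᴴ - (1 / 2 : ℂ) • momentumAnnihilation k 0) * momentumCreation k 0 + momentumCreation k 0 * ((∑ z : FermionTorus 2 L, (torusFourierWeight 2 L * torusChar k z.toTorusSite) • (numberOp z 1 * creation (orb z 0)))ᴴ - (1 / 2 : ℂ) • momentumAnnihilation k 0)) -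
        (U : ℂ) * ∫ τ in (0 : ℝ)..β, cexp (I * k₀ * τ) * gibbsState β (hubbardTorusWith 2 L 1 U μ) (imagTimeEvolve (hubbardTorusWith 2 L 1 U μ) (τ : ℂ) ((∑ z : FermionTorus 2 L, (torusFourierWeight 2 L * torusChar k z.toTorusSite) • (numberOp z 1 * creation (orb z 0)))ᴴ - (1 / 2 : ℂ) • momentumAnnihilation k 0) * ((∑ z : FermionTorus 2 L, (torusFourierWeight 2 L * torusChar k z.toTorusSite) • (numberOp z 1 * creation (orb z 0)))ᴴ - (1 / 2 : ℂ) • momentumAnnihilation k 0)ᴴ) := by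
  have hkc : (k₀ : ℂ) ≠ 0 := by exact_mod_cast ne_zero_of_cexp_eq_neg_one hk
  have hik : (I * k₀ : ℂ) ≠ 0 := mul_ne_zero I_ne_zero hkc
  set H' : Matrix (Finset (Orb (FermionTorus 2 L))) (Finset (Orb (FermionTorus 2 L))) ℂ := hubbardTorusWith 2 L 1 U μ with hH'
  set A : Matrix (Finset (Orb (FermionTorus 2 L))) (Finset (Orb (FermionTorus 2 L))) ℂ := momentumAnnihilation k 0 with hA
  set B : Matrix (Finset (Orb (FermionTorus 2 L))) (Finset (Orb (FermionTorus 2 L))) ℂ := momentumCreation k 0 with hB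
  set Tp : Matrix (Finset (Orb (FermionTorus 2 L))) (Finset (Orb (FermionTorus 2 L))) ℂ := ((∑ z : FermionTorus 2 L, (torusFourierWeight 2 L * torusChar k z.toTorusSite) • (numberOp z 1 * creation (orb z 0)))ᴴ - (1 / 2 : ℂ) • momentumAnnihilation k 0) with hTp
  set ξ : ℂ := ((torusBand L k - μ + U / 2 : ℝ) : ℂ) with hξ
  set G : ℂ := ∫ τ in (0 : ℝ)..β, cexp (I * k₀ * τ) * gibbsState β H' (imagTimeEvolve H' (τ : ℂ) A * B) with hG
  set Y : ℂ := ∫ τ in (0 : ℝ)..β, cexp (I * k₀ * τ) * gibbsState β H' (imagTimeEvolve H' (τ : ℂ) Tp * B) with hY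
  set Z : ℂ := ∫ τ in (0 : ℝ)..β, cexp (I * k₀ * τ) * gibbsState β H' (imagTimeEvolve H' (τ : ℂ) Tp * Tpᴴ) with hZ
  -- the commutators as linear combinations
  have hcA : H' * A - A * H' = (-ξ) • A + (-(U : ℂ)) • Tp := by
    rw [hH', hA, hTp, hξ]
    exact hubbardTorusWith_commutator_momentumAnnihilation_shifted hL U μ k
  have hcB : H' * B - B * H' = ξ • B + (U : ℂ) • Tpᴴ := by
    rw [hH', hB, hTp, hξ]
    exact hubbardTorusWith_commutator_momentumCreation_shifted hL U μ k
  -- (1) one IBP on `⟨c(τ)c†⟩`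
  have h1 := fermionic_matsubara_ibp β H' A B hk
  have hcar : gibbsState β H' (A * B + B * A) = 1 := by rw [hH', hA, hB]; exact gibbsState_momentum_car U μ β k
  rw [hcar, hcA, matsubara_lin_left, ← hG, ← hY] at h1
  -- (2) one IBP on `⟨T′(τ)c†⟩`, derivative moved onto `c†`
  have h2 := fermionic_matsubara_ibp β H' Tp B hk
  have hmove : ∫ τ in (0 : ℝ)..β, cexp (I * k₀ * τ) * gibbsState β H' (imagTimeEvolve H' (τ : ℂ) (H' * Tp - Tp * H') * B) =
      -(ξ * Y + (U : ℂ) * Z) := by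
    have hpt : ∀ τ : ℝ, cexp (I * k₀ * τ) * gibbsState β H' (imagTimeEvolve H' (τ : ℂ) (H' * Tp - Tp * H') * B) =
        -(cexp (I * k₀ * τ) * gibbsState β H' (imagTimeEvolve H' (τ : ℂ) Tp * (H' * B - B * H'))) := fun τ => by
      rw [gibbsState_imagTimeEvolve_comm_mul, mul_neg]
    simp_rw [hpt]
    rw [intervalIntegral.integral_neg, hcB, matsubara_lin_right, ← hY, ← hZ]
  rw [hmove, ← hY] at h2
  constructor
  · have h1' := h1
    field_simp at h1'
    have e1 : G * (I * k₀) = -1 + ξ * G + (U : ℂ) * Y := by linear_combination h1'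
    linear_combination -e1
  · have h2' := h2
    field_simp at h2'
    have e2 : Y * (I * k₀) = -gibbsState β H' (Tp * B + B * Tp) + ξ * Y + (U : ℂ) * Z := by linear_combination h2'
    linear_combination -e2

/-! ## §3 The exact formula and the volume-, frequency- and coupling-explicit bounds -/

/-- **EXACT, HARTREE-SHIFTED: `(1/D′ − 𝒢)·D′² = U⟨{T′,c†}⟩ − U²𝒵′`**, `D′ = −ik₀ + ε_L(k) − μ + U/2`, for `L ≥ 3`, every real `U, μ, β`, every torus
momentum and every fermionic `k₀` — no `D_κ/D` factors (compare `reamputated_matsubaraGreen_frame_eq` at `κ = U/2`). -/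
theorem reamputated_matsubaraGreen_shifted_eq (hL : 3 ≤ L) (U μ β : ℝ) (k : TorusSite 2 L) {k₀ : ℝ} (hk : cexp (I * k₀ * β) = -1) :
    (1 / (-I * k₀ + ((torusBand L k - μ + U / 2 : ℝ) : ℂ)) -
          ∫ τ in (0 : ℝ)..β, cexp (I * k₀ * τ) * gibbsState β (hubbardTorusWith 2 L 1 U μ) (imagTimeEvolve (hubbardTorusWith 2 L 1 U μ) (τ : ℂ) (momentumAnnihilation k 0) * momentumCreation k 0)) *
        (-I * k₀ + ((torusBand L k - μ + U / 2 : ℝ) : ℂ)) ^ 2 =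
      (U : ℂ) * gibbsState β (hubbardTorusWith 2 L 1 U μ) (((∑ z : FermionTorus 2 L, (torusFourierWeight 2 L * torusChar k z.toTorusSite) • (numberOp z 1 * creation (orb z 0)))ᴴ - (1 / 2 : ℂ) • momentumAnnihilation k 0) * momentumCreation k 0 + momentumCreation k 0 * ((∑ z : FermionTorus 2 L, (torusFourierWeight 2 L * torusChar k z.toTorusSite) • (numberOp z 1 * creation (orb z 0)))ᴴ - (1 / 2 : ℂ) • momentumAnnihilation k 0)) -
        (U : ℂ) ^ 2 * ∫ τ in (0 : ℝ)..β, cexp (I * k₀ * τ) * gibbsState β (hubbardTorusWith 2 L 1 U μ) (imagTimeEvolve (hubbardTorusWith 2 L 1 U μ) (τ : ℂ) ((∑ z : FermionTorus 2 L, (torusFourierWeight 2 L * torusChar k z.toTorusSite) • (numberOp z 1 * creation (orb z 0)))ᴴ - (1 / 2 : ℂ) • momentumAnnihilation k 0) * ((∑ z : FermionTorus 2 L, (torusFourierWeight 2 L * torusChar k z.toTorusSite) • (numberOp z 1 * creation (orb z 0)))ᴴ - (1 / 2 : ℂ) • momentumAnnihilation k 0)ᴴ) := by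
  obtain ⟨e1, e2⟩ := matsubara_dyson_shifted hL U μ β k hk
  have hkr : k₀ ≠ 0 := ne_zero_of_cexp_eq_neg_one hk
  set D : ℂ := (-I * k₀ + ((torusBand L k - μ + U / 2 : ℝ) : ℂ)) with hD
  have hDne : D ≠ 0 := by
    intro h
    have := congrArg Complex.im h
    simp [hD] at this
    exact hkr this
  set G : ℂ := ∫ τ in (0 : ℝ)..β, cexp (I * k₀ * τ) * gibbsState β (hubbardTorusWith 2 L 1 U μ) (imagTimeEvolve (hubbardTorusWith 2 L 1 U μ) (τ : ℂ) (momentumAnnihilation k 0) * momentumCreation k 0) with hG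
  have hred : (1 / D - G) * D ^ 2 = D - (G * D) * D := by
    rw [sub_mul, pow_two, ← mul_assoc, ← mul_assoc, one_div_mul_cancel hDne, one_mul]
  rw [hred, e1]
  linear_combination (U : ℂ) * e2

/-- **`‖𝒵′‖ ≤ (9/4)β`**: the two-time Matsubara transform of the shifted dressed mode is bounded uniformly in the volume, the momentum, the
frequency AND the coupling (`0 ≤ β`; Gibbs bound `|⟨X(τ)Y⟩| ≤ ‖X‖‖Y‖`, `‖T′‖ ≤ 3/2`). -/
theorem norm_shiftedDressedMatsubara_le (U μ : ℝ) {β : ℝ} (hβ : 0 ≤ β) (k : TorusSite 2 L) (k₀ : ℝ) :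
    ‖∫ τ in (0 : ℝ)..β, cexp (I * k₀ * τ) * gibbsState β (hubbardTorusWith 2 L 1 U μ) (imagTimeEvolve (hubbardTorusWith 2 L 1 U μ) (τ : ℂ) ((∑ z : FermionTorus 2 L, (torusFourierWeight 2 L * torusChar k z.toTorusSite) • (numberOp z 1 * creation (orb z 0)))ᴴ - (1 / 2 : ℂ) • momentumAnnihilation k 0) * ((∑ z : FermionTorus 2 L, (torusFourierWeight 2 L * torusChar k z.toTorusSite) • (numberOp z 1 * creation (orb z 0)))ᴴ - (1 / 2 : ℂ) • momentumAnnihilation k 0)ᴴ)‖ ≤ 9 / 4 * β := by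
  haveI : Nonempty (Finset (Orb (FermionTorus 2 L))) := ⟨∅⟩
  have hH := isHermitian_hamiltonianWith (fermionTorusGraph 2 L) 1 U μ
  refine (norm_fermionic_matsubara_le (H := hubbardTorusWith 2 L 1 U μ) hH hβ _ _ k₀).trans ?_
  have h1 := norm_shiftedDressed_le (L := L) k
  have h2 := norm_shiftedDressed_conjTranspose_le (L := L) k
  calc β * (‖((∑ z : FermionTorus 2 L, (torusFourierWeight 2 L * torusChar k z.toTorusSite) • (numberOp z 1 * creation (orb z 0)))ᴴ - (1 / 2 : ℂ) • momentumAnnihilation k 0)‖ * ‖((∑ z : FermionTorus 2 L, (torusFourierWeight 2 L * torusChar k z.toTorusSite) • (numberOp z 1 * creation (orb z 0)))ᴴ - (1 / 2 : ℂ) • momentumAnnihilation k 0)ᴴ‖)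
      ≤ β * (3 / 2 * (3 / 2)) := by gcongr
    _ = 9 / 4 * β := by ring

/-- **`‖⟨T′c† + c†T′⟩‖ ≤ 3`** (Gibbs state bound, `‖T′‖ ≤ 3/2`, `‖c†‖ ≤ 1`). -/
theorem norm_gibbsState_shiftedAnticommutator_le (U μ β : ℝ) (k : TorusSite 2 L) : ‖gibbsState β (hubbardTorusWith 2 L 1 U μ) (((∑ z : FermionTorus 2 L, (torusFourierWeight 2 L * torusChar k z.toTorusSite) • (numberOp z 1 * creation (orb z 0)))ᴴ - (1 / 2 : ℂ) • momentumAnnihilation k 0) * momentumCreation k 0 + momentumCreation k 0 * ((∑ z : FermionTorus 2 L, (torusFourierWeight 2 L * torusChar k z.toTorusSite) • (numberOp z 1 * creation (orb z 0)))ᴴ - (1 / 2 : ℂ) • momentumAnnihilation k 0))‖ ≤ 3 := by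
  haveI : Nonempty (Finset (Orb (FermionTorus 2 L))) := ⟨∅⟩
  have hH := isHermitian_hamiltonianWith (fermionTorusGraph 2 L) 1 U μ
  have hT := norm_shiftedDressed_le (L := L) k
  have hB : ‖(momentumCreation k 0 : Matrix (Finset (Orb (FermionTorus 2 L))) _ ℂ)‖ ≤ 1 := norm_momentumCreation_le_one k 0
  refine (norm_gibbsState_le (H := hubbardTorusWith 2 L 1 U μ) hH β _).trans ?_
  calc ‖((∑ z : FermionTorus 2 L, (torusFourierWeight 2 L * torusChar k z.toTorusSite) • (numberOp z 1 * creation (orb z 0)))ᴴ - (1 / 2 : ℂ) • momentumAnnihilation k 0) * momentumCreation k 0 + momentumCreation k 0 * ((∑ z : FermionTorus 2 L, (torusFourierWeight 2 L * torusChar k z.toTorusSite) • (numberOp z 1 * creation (orb z 0)))ᴴ - (1 / 2 : ℂ) • momentumAnnihilation k 0)‖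
      ≤ ‖((∑ z : FermionTorus 2 L, (torusFourierWeight 2 L * torusChar k z.toTorusSite) • (numberOp z 1 * creation (orb z 0)))ᴴ - (1 / 2 : ℂ) • momentumAnnihilation k 0)‖ * ‖(momentumCreation k 0 : Matrix (Finset (Orb (FermionTorus 2 L))) _ ℂ)‖ +
          ‖(momentumCreation k 0 : Matrix (Finset (Orb (FermionTorus 2 L))) _ ℂ)‖ * ‖((∑ z : FermionTorus 2 L, (torusFourierWeight 2 L * torusChar k z.toTorusSite) • (numberOp z 1 * creation (orb z 0)))ᴴ - (1 / 2 : ℂ) • momentumAnnihilation k 0)‖ :=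
        (norm_add_le _ _).trans (add_le_add (norm_mul_le _ _) (norm_mul_le _ _))
    _ ≤ 3 / 2 * 1 + 1 * (3 / 2) := by gcongr
    _ = 3 := by norm_num

/-- **`O(U)` BOUND WITHOUT FRAME FACTORS**: `‖(1/D′ − 𝒢)·D′²‖ ≤ 3|U| + (9/4)β·U²` for `L ≥ 3`, `0 ≤ β`, every real `U, μ`, torus momentum and
fermionic `k₀` (compare `norm_reamputated_matsubaraGreen_frame_le` at `κ = U/2`, which carries `(1 + |U|/(2|k₀|))²`). -/
theorem norm_reamputated_matsubaraGreen_shifted_le (hL : 3 ≤ L) (U μ : ℝ) {β : ℝ} (hβ : 0 ≤ β) (k : TorusSite 2 L) {k₀ : ℝ}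
    (hk : cexp (I * k₀ * β) = -1) :
    ‖(1 / (-I * k₀ + ((torusBand L k - μ + U / 2 : ℝ) : ℂ)) -
          ∫ τ in (0 : ℝ)..β, cexp (I * k₀ * τ) * gibbsState β (hubbardTorusWith 2 L 1 U μ) (imagTimeEvolve (hubbardTorusWith 2 L 1 U μ) (τ : ℂ) (momentumAnnihilation k 0) * momentumCreation k 0)) *
        (-I * k₀ + ((torusBand L k - μ + U / 2 : ℝ) : ℂ)) ^ 2‖ ≤ 3 * |U| + 9 / 4 * β * U ^ 2 := by
  rw [reamputated_matsubaraGreen_shifted_eq hL U μ β k hk]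
  have hm := norm_gibbsState_shiftedAnticommutator_le (L := L) U μ β k
  have hZ := norm_shiftedDressedMatsubara_le (L := L) U μ hβ k k₀
  refine (norm_sub_le _ _).trans ?_
  rw [norm_mul, norm_mul, norm_pow, Complex.norm_real, Real.norm_eq_abs]
  have hU2 : |U| ^ 2 = U ^ 2 := sq_abs U
  nlinarith [abs_nonneg U, hm, hZ, norm_nonneg (gibbsState β (hubbardTorusWith 2 L 1 U μ) (((∑ z : FermionTorus 2 L, (torusFourierWeight 2 L * torusChar k z.toTorusSite) • (numberOp z 1 * creation (orb z 0)))ᴴ - (1 / 2 : ℂ) • momentumAnnihilation k 0) * momentumCreation k 0 + momentumCreation k 0 * ((∑ z : FermionTorus 2 L, (torusFourierWeight 2 L * torusChar k z.toTorusSite) • (numberOp z 1 * creation (orb z 0)))ᴴ - (1 / 2 : ℂ) • momentumAnnihilation k 0))), norm_nonneg (∫ τ in (0 : ℝ)..β, cexp (I * k₀ * τ) * gibbsState β (hubbardTorusWith 2 L 1 U μ) (imagTimeEvolve (hubbardTorusWith 2 L 1 U μ) (τ : ℂ) ((∑ z : FermionTorus 2 L, (torusFourierWeight 2 L * torusChar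 k z.toTorusSite) • (numberOp z 1 * creation (orb z 0)))ᴴ - (1 / 2 : ℂ) • momentumAnnihilation k 0) * ((∑ z : FermionTorus 2 L, (torusFourierWeight 2 L * torusChar k z.toTorusSite) • (numberOp z 1 * creation (orb z 0)))ᴴ - (1 / 2 : ℂ) • momentumAnnihilation k 0)ᴴ))]

end Summit.HubbardSuperconductivity.HubbardSuperconductivity.Theorems.ThermalGreen

end
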